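import Summits.HubbardSuperconductivity.HubbardSuperconductivity.Theorems.BalabanIRBirComplexStableXYRStubConstCochainPythagoras
import Summits.HubbardSuperconductivity.HubbardSuperconductivity.Theorems.BalabanIRBirComplexStableXYRStubPathCfgConst
import Summits.HubbardSuperconductivity.HubbardSuperconductivity.Theorems.BalabanIRBirComplexStableXYRStubHolonomyStrainConst
import Summits.HubbardSuperconductivity.HubbardSuperconductivity.Theorems.BalabanIRBirComplexStableXYRStubBerryWeightsReflect
import Summits.HubbardSuperconductivity.HubbardSuperconductivity.Theorems.BalabanIRBirComplexStableXYRStubSpatialBerryZero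
import Summits.HubbardSuperconductivity.HubbardSuperconductivity.Theorems.BalabanIRBirComplexStableXYRStubHolonomyFormSplit
import HarnessLib

/-!
# Crux `BirComplexStableXYR` (stmt-HubbardSuperconductivity-14845), line `fat-gaussian-defect-calculus`:
# stub H1 `stub_holonomySectorData` — the Gaussian data of a vortex-free sector, assembled

Helper (`--supports`) for the crux
`Summit.HubbardSuperconductivity.HubbardSuperconductivity.Theses.BalabanIR.BirComplexStableXYR`, line
`fat-gaussian-defect-calculus` (lead skeleton `Cruxes/BirComplexStableXYR/Lines/fat_gaussian_defect_calculus.lean`,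
lead c8, wave 10), registered stub H1 `stub_holonomySectorData` (chapter 2, holonomy sectors).

**Statement.** On the space–time torus `Λ L M = (Fin 2 → ZMod L) × ZMod M` (chart `TorusChart.piProdZMod 2 L M`,
directions `0, 1` of period `L`, direction `2` of period `M`), for a window Fourier table `c : Table r` (`r ≥ 2`) with
(U1) charge-neutral support, (N) `Σ_n c_n = 0`, the coercivity (C) and the time-reflection Hermiticity (R), let
`P ω s` be the window path configurations (staircase sums, defining hypothesis `hP`), `Q` the real window Hessian form
(defining hypothesis `hQ`) and `m_w = Σ_n Re(c_n) n_w` the Berry weights (hypothesis `hm`).  For an integer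
`1`-cochain `a` with `d₁a = 0` and windings `h`, and ANY strain `σ = 2πa − d₀ψ` with the Pythagoras property
`Σ_s Q(P (d₀u − σ) s) = Σ_s Q(P (d₀u) s) + Σ_s Q(P σ s)`:
(i) `Σ_s Q(P σ s) = |Λ| · (Q(w ↦ x w₁ + y w₂) + (2πh₂/M)² · Q(w ↦ w₃))` with `x = 2πh₀/L`, `y = 2πh₁/L`;
(ii) `Σ_s Σ_w m_w · P σ s w = |Λ| · (2πh₂/M) · Σ_w m_w w₃`.

**Proof (assembly of the landed stubs E1–E6).** (1) By E3 `stub_holonomyStrainConst` (whose constant-cochain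
Pythagoras hypothesis is E1 `stub_constCochainPythagoras`) the strain IS the constant twist
`σ = (x, i) ↦ 2πh_i/N_i`, `N_0 = N_1 = L`, `N_2 = M` (`TorusChart.piProdZMod_period_castSucc/_last`).  (2) By E2
`stub_pathCfg_const` its window configuration at every corner `s` is the linear one,
`P σ s = w ↦ x w₁ + y w₂ + t w₃` with `t = 2πh₂/M`; hence both corner sums are `|Λ|` times a constant
(`Finset.sum_const`).  (3) For (i), E6 `stub_holonomyFormSplit` ((U1), (R)) removes the space–time cross term,
`Q(w ↦ x w₁ + y w₂ + t w₃) = Q(w ↦ x w₁ + y w₂) + Q(w ↦ t w₃)`, and `Q` is homogeneous of degree two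
(`hsd_hessForm_smul`, from `hQ`).  (4) For (ii), `Σ_w m_w (x w₁ + y w₂ + t w₃) = t Σ_w m_w w₃` because the spatial
moments `Σ_w m_w w₁ = Σ_w m_w w₂ = 0` vanish (E5 `stub_spatialBerryZero`, fed with the (R)-oddness of `m` from E4
`stub_berryWeightsReflect`).  Elementary; no definition and no named fact is introduced; sorry-free. [folklore]
-/

set_option linter.dupNamespace false -- `Summit.<S>.<S>.Theorems…` repeats the summit name (D-0017 layout)

namespace Summit.HubbardSuperconductivity.HubbardSuperconductivity.Theorems.FSUnfolding

open scoped BigOperators ComplexConjugate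
open Literature.MathematicalPhysics.QuantumFieldTheory Literature.Probability.LatticeModels
open Summit.HubbardSuperconductivity.BirComplexStableXYNegative

/-- **The real window Hessian form is homogeneous of degree two**: with `Q u = Re(−Σ_n c_n (n·u)²)` (hypothesis
`hQ`), `Q (t • f) = t² · Q f` (pull `t` out of every pairing `n·(t f) = t (n·f)`). [folklore] -/
theorem hsd_hessForm_smul {r : ℕ} (c : Table r) (Q : (W r → ℝ) → ℝ)
    (hQ : ∀ u : W r → ℝ, Q u = (-c.sum (fun n a => a * (((∑ w, (n w : ℝ) * u w) ^ 2 : ℝ) : ℂ))).re)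
    (t : ℝ) (f : W r → ℝ) :
    Q (fun w => t * f w) = t ^ 2 * Q f := by
  have h1 : ∀ n : Freq r, ∑ w, (n w : ℝ) * (t * f w) = t * ∑ w, (n w : ℝ) * f w := by
    intro n
    rw [Finset.mul_sum]
    exact Finset.sum_congr rfl fun w _ => by ring
  rw [hQ, hQ, holSplit_hessianForm_re, holSplit_hessianForm_re, mul_neg, Finset.mul_sum]
  congr 1
  refine Finset.sum_congr rfl fun n _ => ?_
  rw [h1 n]
  ring

/-- **Stub H1 `stub_holonomySectorData` (registered signature, verbatim): the Gaussian data of a vortex-free sector,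
assembled.**  Under (U1), (N), (C), (R), `r ≥ 2`: for an integer `1`-cochain `a` with `d₁a = 0` and windings `h`, and
ANY strain `σ = 2πa − d₀ψ` with the Pythagoras property of R9, (i) the Gaussian sector energy is
`Σ_s Q(P σ s) = |Λ|·(Q(w ↦ x w₁ + y w₂) + (2πh₂/M)²·Q(w ↦ w₃))` with `x = 2πh₀/L`, `y = 2πh₁/L` (E3: `σ` is the
constant twist; E2: its window configuration; E6: no space–time cross term; homogeneity of `Q`), and (ii) the Berry
phase functional is `Σ_s Σ_w m_w P σ s w = |Λ|·(2πh₂/M)·Σ_w m_w w₃` (E2, E4/E5: the spatial moments of `m` vanish).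
[folklore] -/
theorem stub_holonomySectorData :
    ∀ (r : ℕ) (c : Table r) (c₀ : ℝ), 2 ≤ r → 0 < c₀ → (∀ n ∈ c.support, ∑ w, n w = 0) →
      c.sum (fun _ a => a) = 0 →
      (∀ φ : W r → ℝ, c₀ * ∑ w, ∑ w', (1 - Real.cos (φ w - φ w')) ≤ (genF c φ).re) →
      (∀ n : Freq r, c (fun w => n (w.1, w.2.1, Fin.rev w.2.2)) = (starRingEnd ℂ) (c (-n))) →
      ∀ (L M : ℕ) [NeZero L] [NeZero M]
      (P : (Λ L M → Fin 3 → ℝ) → Λ L M → W r → ℝ),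
      (∀ (ω : Λ L M → Fin 3 → ℝ) (s : Λ L M) (w : W r), P ω s w =
        (TorusChart.piProdZMod 2 L M).lineSum ω 0 (w.1 : ℕ) s
          + (TorusChart.piProdZMod 2 L M).lineSum ω 1 (w.2.1 : ℕ) (s + (w.1 : ℕ) • (TorusChart.piProdZMod 2 L M).gen 0)
          + (TorusChart.piProdZMod 2 L M).lineSum ω 2 (w.2.2 : ℕ)
            (s + (w.1 : ℕ) • (TorusChart.piProdZMod 2 L M).gen 0 + (w.2.1 : ℕ) • (TorusChart.piProdZMod 2 L M).gen 1)) →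
      ∀ (Q : (W r → ℝ) → ℝ),
      (∀ u : W r → ℝ, Q u = (-c.sum (fun n a => a * (((∑ w, (n w : ℝ) * u w) ^ 2 : ℝ) : ℂ))).re) →
      ∀ (m : W r → ℝ), (∀ w : W r, m w = c.sum (fun n a => a.re * (n w : ℝ))) →
      ∀ (h : Fin 3 → ℤ) (a : Λ L M → Fin 3 → ℤ), (TorusChart.piProdZMod 2 L M).d₁ a = 0 →
        (TorusChart.piProdZMod 2 L M).wind a = h →
      ∀ (σ : Λ L M → Fin 3 → ℝ),
        (∃ ψ : Λ L M → ℝ, σ = fun x i => 2 * Real.pi * (a x i : ℝ) - (TorusChart.piProdZMod 2 L M).d₀ ψ x i) →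
        (∀ u : Λ L M → ℝ,
          ∑ s : Λ L M, Q (P (fun x i => (TorusChart.piProdZMod 2 L M).d₀ u x i - σ x i) s) =
            ∑ s : Λ L M, Q (P ((TorusChart.piProdZMod 2 L M).d₀ u) s) + ∑ s : Λ L M, Q (P σ s)) →
        (∑ s : Λ L M, Q (P σ s) =
          (Fintype.card (Λ L M) : ℝ) *
            (Q (fun w : W r => 2 * Real.pi * (h 0 : ℝ) / L * ((w.1 : ℕ) : ℝ) + 2 * Real.pi * (h 1 : ℝ) / L * ((w.2.1 : ℕ) : ℝ))
              + (2 * Real.pi * (h 2 : ℝ) / M) ^ 2 * Q (fun w : W r => ((w.2.2 : ℕ) : ℝ)))) ∧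
        (∑ s : Λ L M, ∑ w : W r, m w * P σ s w =
          (Fintype.card (Λ L M) : ℝ) * (2 * Real.pi * (h 2 : ℝ) / M) * ∑ w : W r, m w * ((w.2.2 : ℕ) : ℝ)) := by
  intro r c c₀ hr hc₀ hU1 hN hC hR L M _ _ P hP Q hQ m hm h a hd₁ hwind σ hσ hpyth
  -- (1) E3 (+ E1): the strain is the constant twist `(x, i) ↦ 2π h i / N_i`
  have hσc : σ = fun _ i => 2 * Real.pi * (h i : ℝ) / ((TorusChart.piProdZMod 2 L M).period i : ℝ) :=
    stub_holonomyStrainConst r c c₀ hr hc₀ hN hC L M P hP Q hQ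
      (stub_constCochainPythagoras r c L M P hP Q hQ) h a hd₁ hwind σ hσ hpyth
  -- the periods of the space–time chart (`0, 1 ↦ L`, `2 ↦ M`)
  have hper0 : (TorusChart.piProdZMod 2 L M).period (0 : Fin 3) = L := TorusChart.piProdZMod_period_castSucc 2 L M 0
  have hper1 : (TorusChart.piProdZMod 2 L M).period (1 : Fin 3) = L := TorusChart.piProdZMod_period_castSucc 2 L M 1
  have hper2 : (TorusChart.piProdZMod 2 L M).period (2 : Fin 3) = M := TorusChart.piProdZMod_period_last 2 L M
  -- (2) E2: at every corner the window configuration of `σ` is the linear one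
  have hPσ : ∀ s : Λ L M, P σ s = fun w : W r =>
      2 * Real.pi * (h 0 : ℝ) / L * ((w.1 : ℕ) : ℝ) + 2 * Real.pi * (h 1 : ℝ) / L * ((w.2.1 : ℕ) : ℝ)
        + 2 * Real.pi * (h 2 : ℝ) / M * ((w.2.2 : ℕ) : ℝ) := by
    intro s
    funext w
    rw [hσc, stub_pathCfg_const r L M P hP, hper0, hper1, hper2]
    ring
  refine ⟨?_, ?_⟩
  · -- (3) E6 splits off the temporal part, and `Q` is homogeneous of degree two
    have hQs : ∀ s : Λ L M, Q (P σ s) =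
        Q (fun w : W r => 2 * Real.pi * (h 0 : ℝ) / L * ((w.1 : ℕ) : ℝ) + 2 * Real.pi * (h 1 : ℝ) / L * ((w.2.1 : ℕ) : ℝ))
          + (2 * Real.pi * (h 2 : ℝ) / M) ^ 2 * Q (fun w : W r => ((w.2.2 : ℕ) : ℝ)) := by
      intro s
      rw [hPσ s, stub_holonomyFormSplit r c hU1 hR Q hQ, hsd_hessForm_smul c Q hQ]
    simp only [hQs, Finset.sum_const, Finset.card_univ, nsmul_eq_mul]
  · -- (4) E2, and the spatial moments of the Berry weights vanish (E5, fed with E4)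
    obtain ⟨-, h1, h2⟩ := stub_spatialBerryZero r c hU1 m hm (stub_berryWeightsReflect r c hR m hm)
    have hw : ∀ (s : Λ L M) (w : W r), m w * P σ s w =
        2 * Real.pi * (h 0 : ℝ) / L * (m w * ((w.1 : ℕ) : ℝ)) + 2 * Real.pi * (h 1 : ℝ) / L * (m w * ((w.2.1 : ℕ) : ℝ))
          + 2 * Real.pi * (h 2 : ℝ) / M * (m w * ((w.2.2 : ℕ) : ℝ)) := by
      intro s w
      simp only [hPσ]
      ring
    simp only [hw, Finset.sum_add_distrib, ← Finset.mul_sum, h1, h2, mul_zero, zero_add, Finset.sum_const,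
      Finset.card_univ, nsmul_eq_mul]
    ring

end Summit.HubbardSuperconductivity.HubbardSuperconductivity.Theorems.FSUnfolding
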